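import Mathlib.Data.ENat.Lattice
import Mathlib.GroupTheory.SpecificGroups.Cyclic
import Summits.BirchSwinnertonDyer.BirchSwinnertonDyer.Theorems.Rank1ResidualJetSection6
import Summits.BirchSwinnertonDyer.BirchSwinnertonDyer.Theorems.ClassRecordThreeEulerHalvesAtThreeCoreVertex
import HarnessLib

/-!
# Jetchev 2008 §6 as ONE kernel theorem over abstract Selmer data: Thm. 6.3 ∘ Prop. 6.4 JOINED —
# `ord_p c_q ≤ m(c)` for every conductor `c` carrying the level-`p^k` families, with NO core-vertex
# hypothesis; and the end of the line `ord_p c_q ≤ m_∞` (cell `bsd-stepL`, seat `bsd-stepL-tam3-p1`,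
# helper toward item 19109 `EulerHalvesAtThree`, stub `stub_jetchevMaxHLAtThree`)

HONEST FRAMING. Nothing here proves BSD, J₃ or the divisibility of any Heegner point of any curve;
the registered stub `stub_jetchevMaxHLAtThree` (D. Jetchev, Compos. Math. **144** (2008) 811–826,
Thm. 1.4 READ at `p = 3 ∥ N`) is NOT discharged — its instantiation layer (S1 signs, S2 the Selmer
structures `𝓕(c)`, `𝓕_⌈q⌉(c)`, `𝓕^ℓ(c)` on `H¹(K, E[p^k])`, S3 (δ), S4 Lemma 6.1 at level `p^k`, S5–S7,
S9–S10 of the `bsd-jet` sheet `PV2-J6-KERNEL.md`) is not in the tree; no item closes; 0 classes move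
(T7); `--supports stmt-BirchSwinnertonDyer-19109` (helper). WHAT THIS FILE DOES: after
`…EulerHalvesAtThreeCoreVertex.lean` (Prop. 6.4 as the theorem `exists_halfCoreVertex`) the abstract
§6 of [J] no longer needs any existential hypothesis: `tamagawaExponent_le_m_of_selmerFamilies` takes
the level-`p^k` families at a base conductor `c` — block 1 = the data of `exists_halfCoreVertex`
(Kummer structure, duality count per prime and sign, Lemma 6.1, the classes with §3.1 ∕ Prop. 4.7),
block 2 = AT EVERY conductor `c·n` the `−ε(cn)`-side stringent data of Thm. 6.3 in exactly the shape
of p471669's `tamagawaExponent_le_mInfty_of_minimalCoreVertex` (Thm. 5.1 at the carrier for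
`𝓕_⌈q⌉(cn) ≼ 𝓕(cn)`, (δ) cyclic of order `p^t`, Thm. 5.1 ∕ Lemma 5.2 (iii) at `λ` for
`𝓕_⌈q⌉(cn) ≼ (𝓕_⌈q⌉)^ℓ(cn)`, Prop. 4.9 for the conductor `cnℓ`) — and concludes `t ≤ m(c)`
(`t = ord_p c_q`). PROOF: the half-core vertex `cn` of `exists_halfCoreVertex`, then the printed `−ε`
computation of Thm. 6.3 there (proof adapted from p471669 to ONE ambient group `H¹(K, E[p^k])` with
eigen-subgroups `Gs ±`, the formulation in which the walk — which alternates signs — type-checks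
without transport). `tamagawaExponent_le_mInfty_of_perLevel` ∕ `depth_le_mdiv_of_perLevel`: with
Kolyvagin's redefinition of `m_∞` (McCallum 1991 Prop. 5.2) the per-(level, conductor) inequality
gives `t ≤ m_∞` and the depth form `s ≤ m'(c)` (`s ≤ t`, `s ≤ M(c)`) = the currency of
`stub_jetchevMaxHLAtThree` ∕ `JET.JetchevDivisibilityCarrier*`. So the kernel distance of the stub is
now EXACTLY the instantiation layer; the §6 bookkeeping, INCLUDING the existence of core vertices, is
kernel-proved and carrier-blind (no datum about the reduction at `p`, `q` versus `p`, or `N`).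
Dictionary: as in `exists_halfCoreVertex` (block 1) and p471669 (block 2, with `A' ↦ Sel n (!e n)`,
`Hp ∕ Hm ↦ Gs (e n) ∕ Gs (!e n)`, `ι ↦ {ℓ : P // ℓ ∉ n}`, `κℓ ℓ ↦ κ (insert ℓ n)`, `mInf ↦ m(cn)`).
References (locators only, no cited FACT declared): [cite: Jetchev2008, §3.1, Prop. 4.7, Prop. 4.9,
Thm. 5.1, Lemma 5.2, Lemma 6.1, Thm. 6.3, Prop. 6.4, Proof of Thm. 1.4 (pp. 816–825)]
[cite: McCallumLMS1991, Cor. 3.2 (p. 299), Prop. 5.2 (p. 304)]. Design: no definitions;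
`Type*`-polymorphic; `Nat.card`; ENat. Axioms: `propext`, `Classical.choice`, `Quot.sound`.
-/

set_option autoImplicit false

noncomputable section

open scoped Classical

namespace Summit.BirchSwinnertonDyer.Rank1Residual.JET.Section6

variable {G : Type*} [AddCommGroup G] {P : Type*} [DecidableEq P]
  {L : P → Type*} [∀ ℓ, AddCommGroup (L ℓ)]

/-- **[J] §6 joined: Thm. 6.3 at the half-core vertex delivered by Prop. 6.4 (`exists_halfCoreVertex`)
— `t = ord_p c_q ≤ m(c)` for every base conductor `c` with `m(c) < k`, `t ≤ k`, carrying the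
level-`p^k` families.** The first block of hypotheses is that of `exists_halfCoreVertex` (Kummer
structure: `Sel`, `Rel`, `Hf`, `Htr`, global duality `hPT`, signs `e`, Lemma 6.1 `h61`, the classes
`κ, κ̃` with §3.1 ∕ Prop. 4.7); the second block is, AT EVERY conductor `c·n`, the `−ε(cn)`-side
stringent data of Thm. 6.3 in the shape of p471669's `tamagawaExponent_le_mInfty_of_minimalCoreVertex`:
`B' n ↦ 𝓗_{𝓕₀(cn)}^{−ε} ≤ 𝓗_{𝓕(cn)}^{−ε}` (`𝓕₀ = 𝓕_⌈q⌉ ≼ 𝓕`), `C' n ↦ 𝓗_{𝓕₀(cn)^*}^{−ε} ≤ H¹(K,E[p^k])^{−ε}`,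
Thm. 5.1 at the carrier for `𝓕₀(cn) ≼ 𝓕(cn)` (`locq`, `locq'`, `hker`, `horth_q`) with (δ) `Q' n` cyclic
of order `p^t`, and for every `ℓ ∉ n`: `D' n ℓ ↦ 𝓗_{(𝓕₀)^ℓ(cn)}^{−ε}`, Thm. 5.1 ∕ Lemma 5.2 (iii) at `λ`
for `𝓕₀(cn) ≼ (𝓕₀)^ℓ(cn)` (`sing`, `hsing`, `horth_ℓ`), and Prop. 4.9 for the conductor `cnℓ`
(`h49 : κ_{cnℓ,k} ∈ D' n ℓ`). CONCLUSION `t ≤ m(c)`. PROOF: `exists_halfCoreVertex` gives `n` with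
`𝓗_{𝓕(cn)}^{−ε(cn)} = 0`, `m(cn) ≤ m(c)`; there the printed `−ε` computation of Thm. 6.3 (as in p471669,
adapted to one ambient group with eigen-subgroups) gives `t ≤ m(cn)`. With Kolyvagin's redefinition
of `m_∞` (McCallum 1991 Prop. 5.2: some `c` of arbitrarily large `M(c)` has `m(c) = m_∞`) this is
`t ≤ m_∞`, i.e. Thm. 1.4 for the carrier `q` — the caller supplies that `c`.
[cite: Jetchev2008, Thm. 6.3, Prop. 6.4, Proof of Thm. 1.4 (pp. 822–825)] [cite: McCallumLMS1991, Prop. 5.2 (p. 304)] -/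
theorem tamagawaExponent_le_m_of_selmerFamilies
    {p k t : ℕ} (hp : p.Prime) (htk : t ≤ k)
    -- block 1: the data of `exists_halfCoreVertex`
    (loc : ∀ ℓ : P, G →+ L ℓ) (Hf Htr : ∀ ℓ : P, Bool → AddSubgroup (L ℓ))
    (hdisj : ∀ ℓ s, Disjoint (Hf ℓ s) (Htr ℓ s))
    (Gs : Bool → AddSubgroup G) (Sel : Finset P → Bool → AddSubgroup G)
    (Rel : Finset P → P → Bool → AddSubgroup G) (hSelGs : ∀ n s, Sel n s ≤ Gs s)
    (hfin : ∀ n ℓ s, ℓ ∉ n → Finite (Rel n ℓ s))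
    (hSel : ∀ n ℓ s, ℓ ∉ n → Sel n s = Rel n ℓ s ⊓ (Hf ℓ s).comap (loc ℓ))
    (hSelT : ∀ n ℓ s, ℓ ∉ n → Sel (insert ℓ n) s = Rel n ℓ s ⊓ (Htr ℓ s).comap (loc ℓ))
    (hPT : ∀ n ℓ s, ℓ ∉ n → Nat.card ((Rel n ℓ s).map (loc ℓ)) = p ^ k)
    (e : Finset P → Bool) (he : ∀ n ℓ, ℓ ∉ n → e (insert ℓ n) = !e n)
    (h61 : ∀ (s : Bool) (x y : G), x ∈ Gs s → y ∈ Gs (!s) → y ≠ 0 → ∀ n : Finset P,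
      ∃ ℓ, ℓ ∉ n ∧ addOrderOf (loc ℓ x) = addOrderOf x ∧ addOrderOf (loc ℓ y) = addOrderOf y)
    (M mdiv mc : Finset P → ℕ∞) (hm : ∀ n, mdiv n < M n → mc n ≤ mdiv n)
    (hM : ∀ n, (k : ℕ∞) + mc ∅ ≤ M n)
    (κ κt : Finset P → G)
    (hκt : ∀ n, mc n + k ≤ M n →
      κt n ∈ Sel n (e n) ∧ addOrderOf (κt n) = p ^ k ∧ κ n = p ^ (mc n).toNat • κt n)
    (hordκ : ∀ n (j : ℕ), j < k → p ^ (k - j) ∣ addOrderOf (κ n) → mdiv n ≤ j)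
    (h47 : ∀ n ℓ, ℓ ∉ n → addOrderOf (loc ℓ (κ (insert ℓ n))) = addOrderOf (loc ℓ (κ n)))
    (h0 : mc ∅ < k)
    -- block 2: the `−ε(cn)`-side stringent data of Thm. 6.3 at every conductor `cn`
    (B' C' : Finset P → AddSubgroup G) (hB' : ∀ n, B' n ≤ Sel n (!e n))
    (hC'Gs : ∀ n, C' n ≤ Gs (!e n))
    {Q Q' : Finset P → Type*} [∀ n, AddCommGroup (Q n)] [∀ n, AddCommGroup (Q' n)]
    [∀ n, Finite (Q' n)]
    (locq : ∀ n, ↥(Sel n (!e n)) →+ Q n) (locq' : ∀ n, ↥(C' n) →+ Q' n)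
    (hker : ∀ n (x : C' n), locq' n x = 0 ↔ (x : G) ∈ Sel n (!e n))
    (horth_q : ∀ n, Nat.card (locq n).range * Nat.card (locq' n).range = Nat.card (Q' n))
    (hQ'cyc : ∀ n, IsAddCyclic (Q' n)) (hQ'card : ∀ n, Nat.card (Q' n) = p ^ t)
    (D' : Finset P → P → AddSubgroup G)
    {S : Finset P → P → Type*} [∀ n ℓ, AddCommGroup (S n ℓ)] (sing : ∀ n ℓ, ↥(D' n ℓ) →+ S n ℓ)
    (hsing : ∀ n ℓ (x : D' n ℓ), ℓ ∉ n → (sing n ℓ x = 0 ↔ (x : G) ∈ B' n))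
    (horth_ℓ : ∀ n ℓ, ℓ ∉ n →
      Nat.card (sing n ℓ).range * Nat.card ((C' n).map (loc ℓ)) = p ^ k)
    (h49 : ∀ n ℓ, ℓ ∉ n → κ (insert ℓ n) ∈ D' n ℓ) :
    (t : ℕ∞) ≤ mc ∅ := by
  -- trivial when `t = 0`
  rcases Nat.eq_zero_or_pos t with ht0 | ht0
  · simp [ht0]
  -- Prop. 6.4: a half-core vertex `cn` with `m(cn) ≤ m(c)`
  obtain ⟨n, hcore, hn⟩ := exists_halfCoreVertex hp loc Hf Htr hdisj Gs Sel Rel hSelGs hfin hSel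
    hSelT hPT e he h61 M mdiv mc hm hM κ κt hκt hordκ h47 h0
  -- bookkeeping at `cn`
  have hk0 : 0 < k := lt_of_lt_of_le ht0 htk
  have hmcn_lt : mc n < (k : ℕ∞) := lt_of_le_of_lt hn h0
  have hmcn_ne : mc n ≠ ⊤ := ne_top_of_lt hmcn_lt
  set u : ℕ := (mc n).toNat with hu
  have hmcu : mc n = (u : ℕ∞) := (ENat.coe_toNat hmcn_ne).symm
  have huk : u < k := by
    have : ((u : ℕ) : ℕ∞) < (k : ℕ∞) := hmcu ▸ hmcn_lt
    exact_mod_cast this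
  have hMn : mc n + k ≤ M n :=
    calc mc n + (k : ℕ∞) ≤ mc ∅ + k := add_le_add hn le_rfl
      _ = (k : ℕ∞) + mc ∅ := add_comm _ _
      _ ≤ M n := hM n
  obtain ⟨hκtSel, hκtord, hκeq⟩ := hκt n hMn
  -- it suffices to prove `t ≤ m(cn)`
  suffices htu : t ≤ u by
    calc (t : ℕ∞) ≤ (u : ℕ∞) := by exact_mod_cast htu
      _ = mc n := hmcu.symm
      _ ≤ mc ∅ := hn
  -- Thm. 6.3 at `cn`, `−ε(cn)` side (the printed computation, as in p471669)
  -- `B' = 0`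
  have hB'0 : B' n = ⊥ := le_bot_iff.mp (hcore ▸ hB' n)
  -- `locq` has trivial source, so `#im locq' = #Q' = p^t`
  have hrange_q : Nat.card (locq n).range = 1 := by
    have : (locq n).range = ⊥ := by
      rw [eq_bot_iff]
      rintro _ ⟨x, rfl⟩
      have hx : (x : G) ∈ (⊥ : AddSubgroup G) := hcore ▸ x.2
      have : x = 0 := by ext; simpa using hx
      simp [this]
    rw [this, AddSubgroup.card_bot]
  have horth := horth_q n
  rw [hrange_q, one_mul, hQ'card n] at horth
  -- `locq'` is injective (kernel `= 𝓗_{𝓕(cn)}^{−ε} = 0`)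
  have hinj : Function.Injective (locq' n) := by
    rw [injective_iff_map_eq_zero]
    intro x hx
    have hx' : (x : G) ∈ (⊥ : AddSubgroup G) := hcore ▸ (hker n x).mp hx
    ext; simpa using hx'
  -- hence `C' n` is cyclic of order `p^t`, generated by some `g`
  haveI : IsAddCyclic (Q' n) := hQ'cyc n
  haveI : IsAddCyclic (C' n) := isAddCyclic_of_injective (locq' n) hinj
  have hcardC' : Nat.card (C' n) = p ^ t := by
    rw [← horth]; exact Nat.card_congr (AddMonoidHom.ofInjective hinj).toEquiv
  obtain ⟨g, hg⟩ := IsAddCyclic.exists_generator (α := C' n)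
  have hordg : addOrderOf (g : G) = p ^ t := by
    rw [AddSubgroup.addOrderOf_coe, addOrderOf_eq_card_of_forall_mem_zmultiples hg, hcardC']
  have hg0 : (g : G) ≠ 0 := by
    intro h
    rw [h, addOrderOf_zero] at hordg
    have : 1 < p ^ t := Nat.one_lt_pow ht0.ne' hp.one_lt
    omega
  have hC'eq : C' n = AddSubgroup.zmultiples (g : G) := by
    apply le_antisymm
    · intro x hx
      obtain ⟨j, hj⟩ := AddSubgroup.mem_zmultiples_iff.mp (hg ⟨x, hx⟩)
      exact AddSubgroup.mem_zmultiples_iff.mpr ⟨j, by simpa using congrArg Subtype.val hj⟩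
    · exact AddSubgroup.zmultiples_le_of_mem g.2
  -- Lemma 6.1 for (`κ̃_{cn}` on the `ε(cn)` side, `g` on the `−ε(cn)` side), `ℓ ∉ n`
  obtain ⟨ℓ, hℓn, hℓx, hℓg⟩ :=
    h61 (e n) (κt n) (g : G) (hSelGs _ _ hκtSel) (hC'Gs n g.2) hg0 n
  rw [hκtord] at hℓx
  rw [hordg] at hℓg
  -- `#loc_λ(C') = p^t`, so `#D' n ℓ = p^(k - t)`
  have hcard_img : Nat.card ((C' n).map (loc ℓ)) = p ^ t := by
    rw [hC'eq, AddMonoidHom.map_zmultiples, Nat.card_zmultiples, hℓg]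
  have hsing_inj : Function.Injective (sing n ℓ) := by
    rw [injective_iff_map_eq_zero]
    intro x hx
    have hx' : (x : G) ∈ (⊥ : AddSubgroup G) := hB'0 ▸ (hsing n ℓ x hℓn).mp hx
    ext; simpa using hx'
  have hcardD : Nat.card (D' n ℓ) = p ^ (k - t) := by
    have h1 : Nat.card (D' n ℓ) = Nat.card (sing n ℓ).range :=
      Nat.card_congr (AddMonoidHom.ofInjective hsing_inj).toEquiv
    have h2 := horth_ℓ n ℓ hℓn
    rw [hcard_img, ← h1, ← Nat.sub_add_cancel htk, pow_add] at h2
    exact Nat.eq_of_mul_eq_mul_right (pow_pos hp.pos t) h2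
  -- the order of `loc_λ κ_{cnℓ}` divides `p^(k - t)` (Prop. 4.9: `κ_{cnℓ} ∈ D'`) …
  have hdvd : addOrderOf (loc ℓ (κ (insert ℓ n))) ∣ p ^ (k - t) :=
    hcardD ▸ addOrderOf_map_dvd_card_of_mem (loc ℓ) (D' n ℓ) (h49 n ℓ hℓn)
  -- … and equals `ord loc_λ κ_{cn} = p^(k - m(cn))` (Prop. 4.7, §3.1 item 7)
  have hordκ' : addOrderOf (loc ℓ (κ n)) = p ^ (k - u) := by
    rw [hκeq, map_nsmul]
    exact addOrderOf_pow_nsmul_eq hp huk.le _ hℓx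
  rw [h47 n ℓ hℓn, hordκ', Nat.pow_dvd_pow_iff_le_right hp.one_lt] at hdvd
  omega

/-- **End of the line: [J] Thm. 1.4 for one carrier from the per-(level, conductor) inequality.**
If for every level `k` and conductor `c` with `m(c) < k`, `t ≤ k`, `k + m(c) ≤ M(c)` one has `t ≤ m(c)`
(= the conclusion of `tamagawaExponent_le_m_of_selmerFamilies`, once the level-`p^k` families at `c`
are instantiated), then Kolyvagin's redefinition of `m_∞` (`hK`: conductors of arbitrarily large `M(c)`
with `m(c) = m_∞`; McCallum 1991 Prop. 5.2) gives `t ≤ m_∞`.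
[cite: Jetchev2008, Proof of Thm. 1.4 (p. 825)] [cite: McCallumLMS1991, Prop. 5.2 (p. 304)] -/
theorem tamagawaExponent_le_mInfty_of_perLevel
    {Λ : Type*} (M m : Λ → ℕ∞) (t mInf : ℕ)
    (hK : ∀ m' : ℕ, ∃ c, (m' : ℕ∞) ≤ M c ∧ m c = mInf)
    (hlev : ∀ (k : ℕ) (c : Λ), m c < (k : ℕ∞) → t ≤ k → (k : ℕ∞) + m c ≤ M c → (t : ℕ∞) ≤ m c) :
    t ≤ mInf := by
  set k : ℕ := max t mInf + 1 with hk
  have htk : t ≤ k := by omega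
  have hInfk : mInf < k := by omega
  obtain ⟨c, hMc, hmc⟩ := hK (k + mInf)
  have h1 : m c < (k : ℕ∞) := by rw [hmc]; exact_mod_cast hInfk
  have h2 : (k : ℕ∞) + m c ≤ M c := by
    rw [hmc]
    calc (k : ℕ∞) + mInf = ((k + mInf : ℕ) : ℕ∞) := by push_cast; ring
      _ ≤ M c := hMc
  have := hlev k c h1 htk h2
  rw [hmc] at this
  exact_mod_cast this

/-- **Depth form** (the currency of `stub_jetchevMaxHLAtThree` ∕ `JET.JetchevDivisibilityCarrier*` ∕
McCallum's `M_∞ ≥ t`): under the per-level inequality and Kolyvagin's redefinition, every derived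
Heegner point `P_c` whose conductor has all Kolyvagin indices `≥ s`, `s ≤ t = ord_p c_q`, is
`p^s`-divisible (`s ≤ m'(c)`). [cite: Jetchev2008, Thm. 1.4 (p. 812)] -/
theorem depth_le_mdiv_of_perLevel
    {Λ : Type*} (M mdiv m : Λ → ℕ∞) (hm : ∀ c, mdiv c < M c → m c ≤ mdiv c)
    (t mInf : ℕ) (hmInf : ∀ c, (mInf : ℕ∞) ≤ m c)
    (hK : ∀ m' : ℕ, ∃ c, (m' : ℕ∞) ≤ M c ∧ m c = mInf)
    (hlev : ∀ (k : ℕ) (c : Λ), m c < (k : ℕ∞) → t ≤ k → (k : ℕ∞) + m c ≤ M c → (t : ℕ∞) ≤ m c)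
    (s : ℕ) (hs : s ≤ t) (c : Λ) (hsc : (s : ℕ∞) ≤ M c) :
    (s : ℕ∞) ≤ mdiv c :=
  depth_le_mdiv_of_le_mInfty M mdiv m hm mInf hmInf
    (tamagawaExponent_le_mInfty_of_perLevel M m t mInf hK hlev) s hs c hsc

end Summit.BirchSwinnertonDyer.Rank1Residual.JET.Section6

end
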